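import Summits.ResolutionOfSingularities.ResolutionOfSingularities.Theorems.PurelyInseparableDim4ResConeLightPairKernel
import Summits.ResolutionOfSingularities.ResolutionOfSingularities.Theorems.PurelyInseparableDim4SwapTransportWindowCore
import Summits.ResolutionOfSingularities.ResolutionOfSingularities.Theorems.PurelyInseparableDim4SwapTransportWindowStepFull
import Summits.ResolutionOfSingularities.ResolutionOfSingularities.Theorems.PurelyInseparableDim4IsolationConverse
import HarnessLib
import HarnessLib.Audit.Tags

/-!
# Purely inseparable four-folds — THE LIGHT-PAIR VIRTUAL STEP AT EVERY PRECISION (slice C, `(5,4)` light pair, hN4-C′ file 2):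
# one real step shadowed by an `M`-INDEPENDENT loss-free slot step of the virtual partner
# (cell `res-dim4-pi`, K2(p) lane, slice C; hN4-C′ = light-pair `(5,4)` re-presentation)

[OURS · counted 0 · cell `res-dim4-pi` · K2(p) lane (LEDGER v8.2: hN4-C′ = res-dim4-p-3); over res-dim4-typ-1 g3's regime-free transport
core `SwapTransport.virtual_core_slot / _rotate` (p705?, `…SwapTransportWindowCore`) and `eG_transfer` (res-dim4-p-7 g4's lemma), with
the kernel rigidity of `…ResConeLightPairKernel`; seat res-dim4-p-3 g4.]  Nothing here proves K2(p)/K2(5), `NoIsolatedTrap 5 5`, TAIL-D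
or resolution of singularities in dimension ≥ 4 / characteristic `p` — NOT proved.  AI kernel work, weaker than expert review.

* `lightPair_forall_of_unique` — «for every precision `M` SOME loss-free translation works» ⇒ «ONE translation works for every `M`»
  (TT uniqueness, `lightPair_translation_unique`).
* **`lightPair_virtual_step`** — the induction step of the honest re-presentation.  DATA: virtual letters `a a′` (slots), `u f` (free),
  fixed for ever; a real light-pair step `A → A′ = step 5 univ jr b A` (child isolated, `e_G = 2`, weights `≤ 1` of total `2`, order
  `6` on both sides, `x^r ∣ F`); a virtual state `B` (order `6`, ledger `x_a x_{a′} ∣ F`, TT(a, a′)) related to `A` along `π` AT EVERY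
  PRECISION (`∀ M, ℛ²_M`).  CONCLUSION: a slot chart `ℓ ∈ {a, a′}`, ONE translation `β` supported off `{a, a′}` and a bijection `π′`
  such that `step 5 univ ℓ β B` is related to `A′` along `π′` AT EVERY PRECISION, with order `6`, ledger `x_a x_{a′} ∣ F`, isolated,
  `e_G = 2` and TT again, and `A′.r = e_{π′a} + e_{π′a′}`.  ROUTE: `step_cases_of_weights` on the real step; slot ⇒ `virtual_core_slot`
  (either slot), rotation ⇒ `virtual_core_rotate` (either dropped slot); for each `M` a Cramer translation at precision `M + N_c + 17`;
  all of them EQUAL by TT; TT passes to the child (`lightPair_TT_step`).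

[cite: CossartJannsenSaito2020, Thm. 3.10(4), Thm. 3.14] [cite: Hauser2010, §§F–G]
bears_on: LADDER-RESOLUTION:D157-DOOR2 (res-dim4-pi · K2(p) slice C · hN4-C′ file 2).
Supports stmt-ResolutionOfSingularities-16155 (helper).
-/

set_option linter.dupNamespace false -- mandated namespace of this single-conjunct summit

noncomputable section

namespace Summit.ResolutionOfSingularities.ResolutionOfSingularities.Theorems.PIDim4

namespace ResCone

open MvPolynomial Finset
open Literature.AlgebraicGeometry.Resolution
open Literature.AlgebraicGeometry.Resolution.CentreBlowup
open Literature.AlgebraicGeometry.Resolution.Hauser2010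
open Literature.AlgebraicGeometry.Resolution.HauserPerlega2019

variable {K : Type} [Field K] [CharP K 5] [DecidableEq K]

omit [CharP K 5] in
/-- **One translation for every precision**: if for every `M` SOME loss-free slot step from the TT state `B` lands at order `6` with
ledger `x_a x_{a′}` and satisfies `P M`, then ONE translation satisfies `P M` for every `M`. [OURS] -/
theorem lightPair_forall_of_unique {B : State K} {ℓ a a' : Fin 4} (hℓ : ℓ = a ∨ ℓ = a') (ho : ordZero B.F = 6)
    (hdiv : ∀ d ∈ B.F.support, B.r ≤ d) (hr : B.r = Finsupp.single a 1 + Finsupp.single a' 1)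
    (hTT : ∀ v ∈ resVertex B, v a = 0 → v a' = 0 → v = 0) {P : ℕ → (Fin 4 → K) → Prop}
    (hex : ∀ M, ∃ β : Fin 4 → K, β a = 0 ∧ β a' = 0 ∧ ordZero (CentreBlowup.step 5 Finset.univ ℓ β B).F = 6 ∧
      (CentreBlowup.step 5 Finset.univ ℓ β B).r = Finsupp.single a 1 + Finsupp.single a' 1 ∧ P M β) :
    ∃ β : Fin 4 → K, β a = 0 ∧ β a' = 0 ∧ ordZero (CentreBlowup.step 5 Finset.univ ℓ β B).F = 6 ∧
      (CentreBlowup.step 5 Finset.univ ℓ β B).r = Finsupp.single a 1 + Finsupp.single a' 1 ∧ ∀ M, P M β := by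
  obtain ⟨β, hβa, hβa', ho₁, hr₁, -⟩ := hex 0
  refine ⟨β, hβa, hβa', ho₁, hr₁, fun M => ?_⟩
  obtain ⟨β', hβ'a, hβ'a', ho₂, hr₂, hP⟩ := hex M
  rw [lightPair_translation_unique hℓ ho hdiv hr hTT hβa hβa' hβ'a hβ'a' ho₁ hr₁ ho₂ hr₂]
  exact hP

/-- **THE LIGHT-PAIR VIRTUAL STEP AT EVERY PRECISION** (statement and route in the module docstring). [OURS]
[cite: CossartJannsenSaito2020, Thm. 3.14] [cite: Hauser2010, §§F–G] -/
theorem lightPair_virtual_step {a a' u f : Fin 4} (haa' : a ≠ a') (hau : a ≠ u) (haf : a ≠ f) (ha'u : a' ≠ u) (ha'f : a' ≠ f)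
    (huf : u ≠ f) {π : Equiv.Perm (Fin 4)} {A A' B : State K} {jr : Fin 4} {b : Fin 4 → K} (hbj : b jr = 0)
    (hstep : A' = CentreBlowup.step 5 Finset.univ jr b A) (hoA : ordZero A.F = 6) (hoA' : ordZero A'.F = 6)
    (hisoA' : IsIsolated 5 A'.F) (heA' : Module.finrank K (resVertex A') = 2) (hw1 : ∀ i, A'.r i ≤ 1)
    (hdeg : A'.r.degree = 2) (hdivA' : ∀ d ∈ A'.F.support, A'.r ≤ d)
    (hrA : A.r = Finsupp.single (π a) 1 + Finsupp.single (π a') 1)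
    (hrel : ∀ M : ℕ, ∃ (θ e : Fin 4 → MvPolynomial (Fin 4) K) (U E : MvPolynomial (Fin 4) K),
        θ (π a) = X a * e a ∧ θ (π a') = X a' * e a' ∧
        constantCoeff (e a) ≠ 0 ∧ constantCoeff (e a') ≠ 0 ∧
        constantCoeff (θ (π u)) = 0 ∧ constantCoeff (θ (π f)) = 0 ∧
        coeff (Finsupp.single u 1) (θ (π u)) * coeff (Finsupp.single f 1) (θ (π f)) -
          coeff (Finsupp.single f 1) (θ (π u)) * coeff (Finsupp.single u 1) (θ (π f)) ≠ 0 ∧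
        constantCoeff U ≠ 0 ∧ E ∈ originIdeal K ^ M ∧ B.F = deletePthPowers 5 (U ^ 5 * aeval θ A.F) + E)
    (hoB : ordZero B.F = 6) (hrB : B.r = Finsupp.single a 1 + Finsupp.single a' 1) (hdivB : ∀ d ∈ B.F.support, B.r ≤ d)
    (hTT : ∀ v ∈ resVertex B, v a = 0 → v a' = 0 → v = 0) :
    ∃ (ℓ : Fin 4) (β : Fin 4 → K) (π' : Equiv.Perm (Fin 4)), (ℓ = a ∨ ℓ = a') ∧ β a = 0 ∧ β a' = 0 ∧
      A'.r = Finsupp.single (π' a) 1 + Finsupp.single (π' a') 1 ∧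
      (∀ M : ℕ, ∃ (θ e : Fin 4 → MvPolynomial (Fin 4) K) (U E : MvPolynomial (Fin 4) K),
          θ (π' a) = X a * e a ∧ θ (π' a') = X a' * e a' ∧
          constantCoeff (e a) ≠ 0 ∧ constantCoeff (e a') ≠ 0 ∧
          constantCoeff (θ (π' u)) = 0 ∧ constantCoeff (θ (π' f)) = 0 ∧
          coeff (Finsupp.single u 1) (θ (π' u)) * coeff (Finsupp.single f 1) (θ (π' f)) -
            coeff (Finsupp.single f 1) (θ (π' u)) * coeff (Finsupp.single u 1) (θ (π' f)) ≠ 0 ∧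
          constantCoeff U ≠ 0 ∧ E ∈ originIdeal K ^ M ∧ (CentreBlowup.step 5 Finset.univ ℓ β B).F = deletePthPowers 5 (U ^ 5 * aeval θ A'.F) + E) ∧
      ordZero (CentreBlowup.step 5 Finset.univ ℓ β B).F = 6 ∧
      (CentreBlowup.step 5 Finset.univ ℓ β B).r = Finsupp.single a 1 + Finsupp.single a' 1 ∧
      (∀ d ∈ (CentreBlowup.step 5 Finset.univ ℓ β B).F.support, (CentreBlowup.step 5 Finset.univ ℓ β B).r ≤ d) ∧
      IsIsolated 5 (CentreBlowup.step 5 Finset.univ ℓ β B).F ∧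
      Module.finrank K (resVertex (CentreBlowup.step 5 Finset.univ ℓ β B)) = 2 ∧
      (∀ v ∈ resVertex (CentreBlowup.step 5 Finset.univ ℓ β B), v a = 0 → v a' = 0 → v = 0) := by
  haveI : Fact (Nat.Prime 5) := ⟨by norm_num⟩
  obtain ⟨Nc, hcert⟩ := IsolationConverse.exists_certificate_of_isIsolated hisoA'
  -- the real chart letter as a virtual letter
  obtain ⟨g₀, rfl⟩ : ∃ g₀, π g₀ = jr := ⟨π.symm jr, π.apply_symm_apply jr⟩
  have hπaa' : π a ≠ π a' := π.injective.ne haa'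
  have hπau : π a ≠ π u := π.injective.ne hau
  have hπaf : π a ≠ π f := π.injective.ne haf
  have hπa'u : π a' ≠ π u := π.injective.ne ha'u
  have hπa'f : π a' ≠ π f := π.injective.ne ha'f
  have hπuf : π u ≠ π f := π.injective.ne huf
  have hw1' : ∀ i, (CentreBlowup.step 5 Finset.univ (π g₀) b A).r i ≤ 1 := by rw [← hstep]; exact hw1
  have hdeg' : (CentreBlowup.step 5 Finset.univ (π g₀) b A).r.degree = 2 := by rw [← hstep]; exact hdeg
  have hrA₂ : A.r = Finsupp.single (π a') 1 + Finsupp.single (π a) 1 := by rw [hrA, add_comm]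
  have hrB₂ : B.r = Finsupp.single a' 1 + Finsupp.single a 1 := by rw [hrB, add_comm]
  rcases SwapTransport.step_cases_of_weights hπaa' hπau hπaf hπa'u hπa'f hπuf hrA hoA hw1' hdeg' with
    ⟨hj, -, hr'⟩ | ⟨hj, -, hr'⟩ | ⟨hjvw, ⟨hbx, hby, hr'⟩ | ⟨hby, hbx, hr'⟩⟩
  · -- SLOT step in the chart `π a`
    have hg₀ : g₀ = a := π.injective hj
    subst hg₀
    have hrA' : A'.r = Finsupp.single (π g₀) 1 + Finsupp.single (π a') 1 := by rw [hstep]; exact hr'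
    have hex : ∀ M, ∃ β : Fin 4 → K, β g₀ = 0 ∧ β a' = 0 ∧
        ordZero (CentreBlowup.step 5 Finset.univ g₀ β B).F = 6 ∧
        (CentreBlowup.step 5 Finset.univ g₀ β B).r = Finsupp.single g₀ 1 + Finsupp.single a' 1 ∧
        ((∃ (θ e : Fin 4 → MvPolynomial (Fin 4) K) (U E : MvPolynomial (Fin 4) K),
            θ (π g₀) = X g₀ * e g₀ ∧ θ (π a') = X a' * e a' ∧
            constantCoeff (e g₀) ≠ 0 ∧ constantCoeff (e a') ≠ 0 ∧
            constantCoeff (θ (π u)) = 0 ∧ constantCoeff (θ (π f)) = 0 ∧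
            coeff (Finsupp.single u 1) (θ (π u)) * coeff (Finsupp.single f 1) (θ (π f)) -
              coeff (Finsupp.single f 1) (θ (π u)) * coeff (Finsupp.single u 1) (θ (π f)) ≠ 0 ∧
            constantCoeff U ≠ 0 ∧ E ∈ originIdeal K ^ M ∧ (CentreBlowup.step 5 Finset.univ g₀ β B).F = deletePthPowers 5 (U ^ 5 * aeval θ A'.F) + E) ∧
        (∀ d ∈ (CentreBlowup.step 5 Finset.univ g₀ β B).F.support, (CentreBlowup.step 5 Finset.univ g₀ β B).r ≤ d) ∧
        IsIsolated 5 (CentreBlowup.step 5 Finset.univ g₀ β B).F ∧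
        Module.finrank K (resVertex (CentreBlowup.step 5 Finset.univ g₀ β B)) = 2) := by
      intro M
      obtain ⟨θ, e, U, E, h1, h2, h3, h4, h5, h6, h7, h8, h9, h10⟩ := hrel (M + Nc + 17)
      obtain ⟨-, -, b', θ', e', U', E', hb'1, hb'2, k1, k2, k3, k4, k5, k6, k7, k8, k9, k10, ko, kr, kdiv, kiso, ke⟩ :=
        SwapTransport.virtual_core_slot (π := π) haa' hau haf ha'u ha'f huf (A := A) (B := B) (θ := θ) (e := e) (U := U) (E := E)
          (M := M + Nc + 17) h1 h2 h3 h4 h5 h6 h7 h8 h9 h10 hoA hrA (A' := A') (b := b) hbj hstep hisoA' hcert hoA' (eG := 2) heA'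
          hw1 hdeg hdivA' hoB hrB hdivB (by omega) (SwapTransport.eG_transfer haa' hau haf ha'u ha'f huf π)
      exact ⟨b', hb'1, hb'2, ko, kr, ⟨θ', e', U', E', k1, k2, k3, k4, k5, k6, k7, k8, Ideal.pow_le_pow_right (by omega) k9, k10⟩,
        kdiv, kiso, ke⟩
    obtain ⟨β, hβa, hβa', ho₁, hr₁, hP⟩ := lightPair_forall_of_unique (Or.inl rfl) hoB hdivB hrB hTT hex
    exact ⟨g₀, β, π, Or.inl rfl, hβa, hβa', hrA', fun M => (hP M).1, ho₁, hr₁, (hP 0).2.1, (hP 0).2.2.1, (hP 0).2.2.2,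
      lightPair_TT_step (Or.inl rfl) hβa hoB hdivB hrB ho₁ hr₁ hTT⟩
  · -- SLOT step in the chart `π a′`
    have hg₀ : g₀ = a' := π.injective hj
    subst hg₀
    have hrA' : A'.r = Finsupp.single (π a) 1 + Finsupp.single (π g₀) 1 := by rw [hstep]; exact hr'
    have hex : ∀ M, ∃ β : Fin 4 → K, β a = 0 ∧ β g₀ = 0 ∧
        ordZero (CentreBlowup.step 5 Finset.univ g₀ β B).F = 6 ∧
        (CentreBlowup.step 5 Finset.univ g₀ β B).r = Finsupp.single a 1 + Finsupp.single g₀ 1 ∧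
        ((∃ (θ e : Fin 4 → MvPolynomial (Fin 4) K) (U E : MvPolynomial (Fin 4) K),
            θ (π a) = X a * e a ∧ θ (π g₀) = X g₀ * e g₀ ∧
            constantCoeff (e a) ≠ 0 ∧ constantCoeff (e g₀) ≠ 0 ∧
            constantCoeff (θ (π u)) = 0 ∧ constantCoeff (θ (π f)) = 0 ∧
            coeff (Finsupp.single u 1) (θ (π u)) * coeff (Finsupp.single f 1) (θ (π f)) -
              coeff (Finsupp.single f 1) (θ (π u)) * coeff (Finsupp.single u 1) (θ (π f)) ≠ 0 ∧
            constantCoeff U ≠ 0 ∧ E ∈ originIdeal K ^ M ∧ (CentreBlowup.step 5 Finset.univ g₀ β B).F = deletePthPowers 5 (U ^ 5 * aeval θ A'.F) + E) ∧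
        (∀ d ∈ (CentreBlowup.step 5 Finset.univ g₀ β B).F.support, (CentreBlowup.step 5 Finset.univ g₀ β B).r ≤ d) ∧
        IsIsolated 5 (CentreBlowup.step 5 Finset.univ g₀ β B).F ∧
        Module.finrank K (resVertex (CentreBlowup.step 5 Finset.univ g₀ β B)) = 2) := by
      intro M
      obtain ⟨θ, e, U, E, h1, h2, h3, h4, h5, h6, h7, h8, h9, h10⟩ := hrel (M + Nc + 17)
      obtain ⟨-, -, b', θ', e', U', E', hb'1, hb'2, k1, k2, k3, k4, k5, k6, k7, k8, k9, k10, ko, kr, kdiv, kiso, ke⟩ :=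
        SwapTransport.virtual_core_slot (π := π) (Ne.symm haa') ha'u ha'f hau haf huf (A := A) (B := B) (θ := θ) (e := e) (U := U)
          (E := E) (M := M + Nc + 17) h2 h1 h4 h3 h5 h6 h7 h8 h9 h10 hoA hrA₂ (A' := A') (b := b) hbj hstep hisoA' hcert hoA'
          (eG := 2) heA' hw1 hdeg hdivA' hoB hrB₂ hdivB (by omega) (SwapTransport.eG_transfer (Ne.symm haa') ha'u ha'f hau haf huf π)
      refine ⟨b', hb'2, hb'1, ko, by rw [kr, add_comm], ⟨θ', e', U', E', k2, k1, k4, k3, k5, k6, k7, k8,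
        Ideal.pow_le_pow_right (by omega) k9, k10⟩, kdiv, kiso, ke⟩
    obtain ⟨β, hβa, hβa', ho₁, hr₁, hP⟩ := lightPair_forall_of_unique (Or.inr rfl) hoB hdivB hrB hTT hex
    exact ⟨g₀, β, π, Or.inr rfl, hβa, hβa', hrA', fun M => (hP M).1, ho₁, hr₁, (hP 0).2.1, (hP 0).2.2.1, (hP 0).2.2.2,
      lightPair_TT_step (Or.inr rfl) hβa' hoB hdivB hrB ho₁ hr₁ hTT⟩
  · -- ROTATION dropping `π a`
    have hrA' : A'.r = Finsupp.single (π g₀) 1 + Finsupp.single (π a') 1 := by rw [hstep]; exact hr'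
    have hg : (g₀ = u ∧ (if g₀ = u then f else u) = f) ∨ (g₀ = f ∧ (if g₀ = u then f else u) = u) := by
      rcases hjvw with h | h
      · exact Or.inl ⟨π.injective h, by rw [if_pos (π.injective h)]⟩
      · have hgf : g₀ = f := π.injective h
        exact Or.inr ⟨hgf, by rw [if_neg (fun h' => huf (h'.symm.trans hgf))]⟩
    have hag : a ≠ g₀ := by rcases hg with ⟨h, -⟩ | ⟨h, -⟩ <;> rw [h]; exacts [hau, haf]
    have ha'g : a' ≠ g₀ := by rcases hg with ⟨h, -⟩ | ⟨h, -⟩ <;> rw [h]; exacts [ha'u, ha'f]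
    have hex : ∀ M, ∃ β : Fin 4 → K, β a = 0 ∧ β a' = 0 ∧
        ordZero (CentreBlowup.step 5 Finset.univ a β B).F = 6 ∧
        (CentreBlowup.step 5 Finset.univ a β B).r = Finsupp.single a 1 + Finsupp.single a' 1 ∧
        ((∃ (θ e : Fin 4 → MvPolynomial (Fin 4) K) (U E : MvPolynomial (Fin 4) K),
            θ (((Equiv.swap a g₀).trans π) a) = X a * e a ∧ θ (((Equiv.swap a g₀).trans π) a') = X a' * e a' ∧
            constantCoeff (e a) ≠ 0 ∧ constantCoeff (e a') ≠ 0 ∧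
            constantCoeff (θ (((Equiv.swap a g₀).trans π) u)) = 0 ∧ constantCoeff (θ (((Equiv.swap a g₀).trans π) f)) = 0 ∧
            coeff (Finsupp.single u 1) (θ (((Equiv.swap a g₀).trans π) u)) * coeff (Finsupp.single f 1) (θ (((Equiv.swap a g₀).trans π) f)) -
              coeff (Finsupp.single f 1) (θ (((Equiv.swap a g₀).trans π) u)) * coeff (Finsupp.single u 1) (θ (((Equiv.swap a g₀).trans π) f)) ≠ 0 ∧
            constantCoeff U ≠ 0 ∧ E ∈ originIdeal K ^ M ∧ (CentreBlowup.step 5 Finset.univ a β B).F = deletePthPowers 5 (U ^ 5 * aeval θ A'.F) + E) ∧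
        (∀ d ∈ (CentreBlowup.step 5 Finset.univ a β B).F.support, (CentreBlowup.step 5 Finset.univ a β B).r ≤ d) ∧
        IsIsolated 5 (CentreBlowup.step 5 Finset.univ a β B).F ∧
        Module.finrank K (resVertex (CentreBlowup.step 5 Finset.univ a β B)) = 2) := by
      intro M
      obtain ⟨θ, e, U, E, h1, h2, h3, h4, h5, h6, h7, h8, h9, h10⟩ := hrel (M + Nc + 17)
      obtain ⟨π', b', θ', e', U', E', hπ', -, -, -, -, hb'1, hb'2, k1, k2, k3, k4, k5, k6, k7, k8, k9, k10, ko, kr, kdiv, kiso,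
          ke⟩ :=
        SwapTransport.virtual_core_rotate (π := π) (a := a) (a' := a') (u := u) (f := f) (g := g₀)
          (gt := if g₀ = u then f else u) haa' hau haf ha'u ha'f huf hg (A := A) (B := B) (θ := θ) (e := e) (U := U) (E := E)
          (M := M + Nc + 17) h1 h2 h3 h4 h5 h6 h7 h8 h9 h10 hoA (A' := A') (b := b) hbj hbx hby hstep hisoA' hcert hoA' (eG := 2)
          heA' hrA' hdivA' hoB hrB hdivB (by omega) (SwapTransport.eG_transfer haa' hau haf ha'u ha'f huf)
      subst hπ'
      exact ⟨b', hb'1, hb'2, ko, kr, ⟨θ', e', U', E', k1, k2, k3, k4, k5, k6, k7, k8, Ideal.pow_le_pow_right (by omega) k9, k10⟩,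
        kdiv, kiso, ke⟩
    obtain ⟨β, hβa, hβa', ho₁, hr₁, hP⟩ := lightPair_forall_of_unique (Or.inl rfl) hoB hdivB hrB hTT hex
    refine ⟨a, β, (Equiv.swap a g₀).trans π, Or.inl rfl, hβa, hβa', ?_, fun M => (hP M).1, ho₁, hr₁, (hP 0).2.1, (hP 0).2.2.1,
      (hP 0).2.2.2, lightPair_TT_step (Or.inl rfl) hβa hoB hdivB hrB ho₁ hr₁ hTT⟩
    rw [hrA', Equiv.trans_apply, Equiv.trans_apply, Equiv.swap_apply_left, Equiv.swap_apply_of_ne_of_ne haa'.symm ha'g]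
  · -- ROTATION dropping `π a′`
    have hrA' : A'.r = Finsupp.single (π g₀) 1 + Finsupp.single (π a) 1 := by rw [hstep]; exact hr'
    have hg : (g₀ = u ∧ (if g₀ = u then f else u) = f) ∨ (g₀ = f ∧ (if g₀ = u then f else u) = u) := by
      rcases hjvw with h | h
      · exact Or.inl ⟨π.injective h, by rw [if_pos (π.injective h)]⟩
      · have hgf : g₀ = f := π.injective h
        exact Or.inr ⟨hgf, by rw [if_neg (fun h' => huf (h'.symm.trans hgf))]⟩
    have hag : a ≠ g₀ := by rcases hg with ⟨h, -⟩ | ⟨h, -⟩ <;> rw [h]; exacts [hau, haf]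
    have ha'g : a' ≠ g₀ := by rcases hg with ⟨h, -⟩ | ⟨h, -⟩ <;> rw [h]; exacts [ha'u, ha'f]
    have hex : ∀ M, ∃ β : Fin 4 → K, β a = 0 ∧ β a' = 0 ∧
        ordZero (CentreBlowup.step 5 Finset.univ a' β B).F = 6 ∧
        (CentreBlowup.step 5 Finset.univ a' β B).r = Finsupp.single a 1 + Finsupp.single a' 1 ∧
        ((∃ (θ e : Fin 4 → MvPolynomial (Fin 4) K) (U E : MvPolynomial (Fin 4) K),
            θ (((Equiv.swap a' g₀).trans π) a) = X a * e a ∧ θ (((Equiv.swap a' g₀).trans π) a') = X a' * e a' ∧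
            constantCoeff (e a) ≠ 0 ∧ constantCoeff (e a') ≠ 0 ∧
            constantCoeff (θ (((Equiv.swap a' g₀).trans π) u)) = 0 ∧ constantCoeff (θ (((Equiv.swap a' g₀).trans π) f)) = 0 ∧
            coeff (Finsupp.single u 1) (θ (((Equiv.swap a' g₀).trans π) u)) * coeff (Finsupp.single f 1) (θ (((Equiv.swap a' g₀).trans π) f)) -
              coeff (Finsupp.single f 1) (θ (((Equiv.swap a' g₀).trans π) u)) * coeff (Finsupp.single u 1) (θ (((Equiv.swap a' g₀).trans π) f)) ≠ 0 ∧
            constantCoeff U ≠ 0 ∧ E ∈ originIdeal K ^ M ∧ (CentreBlowup.step 5 Finset.univ a' β B).F = deletePthPowers 5 (U ^ 5 * aeval θ A'.F) + E) ∧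
        (∀ d ∈ (CentreBlowup.step 5 Finset.univ a' β B).F.support, (CentreBlowup.step 5 Finset.univ a' β B).r ≤ d) ∧
        IsIsolated 5 (CentreBlowup.step 5 Finset.univ a' β B).F ∧
        Module.finrank K (resVertex (CentreBlowup.step 5 Finset.univ a' β B)) = 2) := by
      intro M
      obtain ⟨θ, e, U, E, h1, h2, h3, h4, h5, h6, h7, h8, h9, h10⟩ := hrel (M + Nc + 17)
      obtain ⟨π', b', θ', e', U', E', hπ', -, -, -, -, hb'1, hb'2, k1, k2, k3, k4, k5, k6, k7, k8, k9, k10, ko, kr, kdiv, kiso,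
          ke⟩ :=
        SwapTransport.virtual_core_rotate (π := π) (a := a') (a' := a) (u := u) (f := f) (g := g₀)
          (gt := if g₀ = u then f else u) (Ne.symm haa') ha'u ha'f hau haf huf hg (A := A) (B := B) (θ := θ) (e := e) (U := U)
          (E := E) (M := M + Nc + 17) h2 h1 h4 h3 h5 h6 h7 h8 h9 h10 hoA (A' := A') (b := b) hbj hby hbx hstep hisoA' hcert hoA'
          (eG := 2) heA' hrA' hdivA' hoB hrB₂ hdivB (by omega) (SwapTransport.eG_transfer (Ne.symm haa') ha'u ha'f hau haf huf)
      subst hπ'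
      refine ⟨b', hb'2, hb'1, ko, by rw [kr, add_comm], ⟨θ', e', U', E', k2, k1, k4, k3, k5, k6, k7, k8,
        Ideal.pow_le_pow_right (by omega) k9, k10⟩, kdiv, kiso, ke⟩
    obtain ⟨β, hβa, hβa', ho₁, hr₁, hP⟩ := lightPair_forall_of_unique (Or.inr rfl) hoB hdivB hrB hTT hex
    refine ⟨a', β, (Equiv.swap a' g₀).trans π, Or.inr rfl, hβa, hβa', ?_, fun M => (hP M).1, ho₁, hr₁, (hP 0).2.1, (hP 0).2.2.1,
      (hP 0).2.2.2, lightPair_TT_step (Or.inr rfl) hβa' hoB hdivB hrB ho₁ hr₁ hTT⟩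
    rw [hrA', Equiv.trans_apply, Equiv.trans_apply, Equiv.swap_apply_left, Equiv.swap_apply_of_ne_of_ne haa' hag, add_comm]

end ResCone

end Summit.ResolutionOfSingularities.ResolutionOfSingularities.Theorems.PIDim4

end
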